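import Mathlib
import HarnessLib
import Summits.HubbardSuperconductivity.HubbardSuperconductivity.Theses.ChiralWindow
import Literature.MathematicalPhysics.QuantumLattice.DWaveOrderParameterProofs
import Literature.MathematicalPhysics.QuantumLattice.SymmetricRegimeCertificateT
import Summits.HubbardSuperconductivity.HubbardSuperconductivity.Theorems.ChiralWindowCwChiralConstructionResidual
import Summits.HubbardSuperconductivity.HubbardSuperconductivity.Theorems.ChiralWindowCwChannelInfContinuousFilling
import Summits.HubbardSuperconductivity.HubbardSuperconductivity.Theorems.ChiralWindowCwChannelInfContinuousChemicalPotential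
import Summits.HubbardSuperconductivity.HubbardSuperconductivity.Theorems.ChiralWindowCwChannelInfContinuous
import Summits.HubbardSuperconductivity.HubbardSuperconductivity.Theorems.ChiralWindowCwThesisUFreeAnchor
import Summits.HubbardSuperconductivity.HubbardSuperconductivity.Theorems.ChiralWindowCwChiralConstructionLadderTransfer
import Summits.HubbardSuperconductivity.HubbardSuperconductivity.Theorems.ChiralWindowCwChiralConstructionFillingBelowSevenTenths
import Summits.HubbardSuperconductivity.HubbardSuperconductivity.Theorems.ChiralWindowCwChiralConstructionFillingAtNegThreeTenths
import Summits.HubbardSuperconductivity.HubbardSuperconductivity.Theorems.ChiralWindowCwChiralConstructionKLWindowOfPoint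
import Summits.HubbardSuperconductivity.HubbardSuperconductivity.Theorems.ChiralWindowCwChiralConstructionLadderShellGeometryWide
import Summits.HubbardSuperconductivity.HubbardSuperconductivity.Theorems.ChiralWindowCwChiralConstructionLevelWindowTransfer
import Summits.HubbardSuperconductivity.HubbardSuperconductivity.Theorems.WeakCouplingBCSWcbcsBcsConstructionLadderShellGeometryFn
import Summits.HubbardSuperconductivity.HubbardSuperconductivity.Theorems.CwChiralConstruction.Negative.CooperLegendreCeiling
import Summits.HubbardSuperconductivity.HubbardSuperconductivity.Theorems.ChiralWindowCwKLChiralWindowBlockBoundsX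
import Summits.HubbardSuperconductivity.HubbardSuperconductivity.Theorems.ChiralWindowCwKLChiralWindowStubKlFillingLower
import Summits.HubbardSuperconductivity.HubbardSuperconductivity.Theorems.ChiralWindowCwChiralConstructionKptOfPointLeading
import Summits.HubbardSuperconductivity.HubbardSuperconductivity.Theorems.ChiralWindowCwChiralConstructionPointLeadingOfBox
import Summits.HubbardSuperconductivity.HubbardSuperconductivity.Theorems.ChiralWindowDefsPointRecord

/-!
# Crux `CwChiralConstruction` (stmt-HubbardSuperconductivity-1740) — line `ladder-scale-transfer`, rev c7-2

Route `HubbardSuperconductivity/ChiralWindow`, rank-2 crux ("the programme"). Lead seat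
prover-line-stmt-HubbardSuperconductivity-1740-c7-0 (continuation seat c7, gen 1), 2026-08-17.

## What changed against rev c5-3 (an L4 RESHAPE of the KL input only; composition, (M) and every landed piece unchanged)

rev c5-3 (leads c5/c6) left TWO stubs: (Kpt) `B₁g` leading at ONE window doping — hung on clause (i) of the kill switch
`CwKLChiralWindow` (stmt-1741), i.e. on a 4-box certified record at the `B1g = E` CROSSING `μ ≈ -1.104` (isolation margin
`1e-5`, kernel width needed `1e-5`; no certified box landed in 30 h) — and (M) the open constructive problem. The crossing is
the hardest place in the window to certify anything, and (Kpt) does not need it: this seat moves the KL input to the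
`B1g`-DOMINANT edge of the window, `μ_pt = -21/25` (`n = 0.663`, `δ₀ = 0.337`; float census N = 256/512/1024:
`Λ₁(B1g) = -0.0648` against `B2g -0.0176`, `E -0.0173`, `A1g(χ₀) -0.0147`, `A2g -0.0046` — a ×3.7 lead), where a ONE-POINT
`U = 1` certificate with seven LOOSE inequalities suffices:
* (P1) `stub_kptOfPointLeading` — a `U = 1` leading inequality at a band level `μ ∈ [-111/100, -21/25]` gives (Kpt)
  (`δ₀ := 1 - n(μ) ∈ (3/10, 12/25]` by the LANDED fillings `13/25 ≤ n(-1.11)` p138691 and `n(-21/25) < 7/10` p139953 and the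
  strictly monotone free filling; `chemicalPotentialOfDensity_spec`; `CwThesis.leading_of_certificateOne`). Provable now.
* (P2) `stub_pointLeadingOfBox` — certificate logic for ONE box in stmt-1741's own vocabulary (`KLBox`, `KLBlock.EnclosureR`,
  `templeOKX`/`lowerOKX`/`b1gLeadsOKX`, soundness `stub_klBlockBoundsX` p-landed): Ritz upper bound for the `B1g` trial block,
  Temple/far lower bounds for the four other channels, the rational test `b1gLeadsOKX`. Provable now, generic in the record.
* (P3) `stub_klPointCertificate` — a one-point record at `μ_pt = -21/25` passing those Booleans WHOSE ENCLOSURES HOLD: the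
  certified computation (E1, E2, E3R for the `B1g` trial; E4 deflated sector square masses for all five blocks; `N` to `1e-3`,
  `Q` to ±15 %, `H` to +100…300 % — certified kernel width `δ_A ≈ 1e-3`, 100× looser than any stmt-1741 box, no node cover, no
  `E`-leading, no isolation, no `μ`-transport). Registered in `∃ record` form in rev c7-1; rev c7-2 WITNESSES it by the
  concrete literal `klPtBox`/`klPtTab`/`klPtGamma` (`Theorems/ChiralWindowDefsPointRecord.lean`, p145573 ACCEPTED; Booleans by the
  registered kernel decision `klPt_okX`) plus the one remaining enclosure stub (P3') `stub_klPointEnclosure :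
  ∀ χ, (klPtBox.blk χ).EnclosureR klPtTab (-21/25) χ` — the certified computation (target doc `Cruxes/CwChiralConstruction/PointCertTarget.md`).
(Kpt) is then a THEOREM of the skeleton (`stub_klLeadingAtWindowDoping`, statement byte-identical to rev c5-3), so
`CwChiralConstruction_of` is untouched; the old feed from `CwKLChiralWindow` stays as documentation
(`klLeadingAtWindowDoping_of_cwKLChiralWindow`). Stubs: rev c7-1 (P1), (P2), (P3), (M); rev c7-2: (P1) CLOSED p146657, (P2) CLOSED
p148296 (wave-1 workers), (P3) witnessed ⇒ OPEN = (P3') `stub_klPointEnclosure` [computation] + (M) [research, promote standing].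

## What rev c5-3 changed against rev c4-2 (kept verbatim below)

rev c4-2 (lead c4) closed the crux from three stubs shared VERBATIM with crux stmt-2010's line
`ladder-scale-certified-chain` — (K1) certified Kohn–Luttinger `B₁g` leading at `U = 1` on `μ ∈ [-9/10,-3/10]`,
(R1) the symmetric flow to a ladder scale on the Grassmann window `ν ∈ [-17/20,-7/20]`, (B) the broken regime at the
ladder scale — plus the certified filling (T) `n(-21/25) < 7/10` (landed p139953) and landed transfers.

Observation of this seat: the KL input this crux needs is NOT a window certificate nobody is producing ((K1) is the
missing object of support item stmt-0158 on a window chosen for the sibling's equation of state), but ONE POINT: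
`B₁g` strictly leading, with a `γU²` margin, at ONE window doping `δ₀ ∈ [3/10, 12/25]` — stub (Kpt) below. That datum is

* clause (i) of this route's own kill-switch crux `CwKLChiralWindow` (stmt-1741, rank 1; its chain is closed modulo the
  certified box enclosures `stub_klRecordBoxesX`) — `klLeadingAtWindowDoping_of_cwKLChiralWindow` (proved here);
* implied by the sibling's (K1) as well (`δ₀ := 3/10`, `μ(7/10) ∈ [-9/10,-3/10]` by (T) and (F2)) —
  `klLeadingAtWindowDoping_of_K1` (proved here);
* exactly the "leading datum at one window doping" consumed by crux `CwThesis`'s line (`cwThesis_of_klCanonical_of_leading`).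

From the point datum, a PROVABLE-NOW theorem (stub (Kwin), this seat's own) produces a `μ`-WINDOW on which `B₁g` leads by
`(γ/2)U²` uniformly in `U ≤ U₁/2`, with certified free fillings strictly inside `(13/25, 7/10)`: continuity of
`δ ↦ channelInf ε (μ δ) U χ` on `[1/4, 12/25]` (support item stmt-1744, PROVED) at the two couplings `U = 1` (non-`A1g`
channels scale exactly like `U²`, `channelInf_sq_of_ne_A1g`) and `U = U₁/2` (for `A1g`, whose bottom divided by `U²` is
ANTITONE in `U` — the bare repulsion `U(∫ψ)²` only grows relative to `U²` as `U ↓` — so the inequality at `U₁/2`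
propagates to every smaller `U`).

The symmetric-flow stub is restated in its natural LOCAL form (Rloc): for ANY level window `[μ₁, μ₂] ⊂ [-2, -3/10]` on
which `B₁g` leads by `γU²`, ladder-scale certificates for the Grassmann levels `ν ∈ [μ₁, μ₂ - U/2]` (operator level
`ν + U/2 ∈ [μ₁, μ₂]`). The sibling's (R1) is the instance `[μ₁, μ₂] = [-9/10, -3/10]` (`siblingCore_of_local`, proved
here from (Rloc) + the landed `U = 1 ⇒ γU²` reduction), so ONE research item (Rloc) serves both cruxes. (B) is kept
verbatim (shared). The shell geometry of the record is needed on the wider level range `ν ∈ [-2, -3/10]` (stub (Gw),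
closable now: the sibling's function-form proof p138830 with `S = cos p₀ + cos p₁ ∈ [0.139, 1.011]`).

Registered stubs — rev c5-3 (2 ≤ stubs_max 7; rev c7-1 replaces (Kpt) by (P1)+(P2)+(P3), see the top of this header):
* (Kpt) `stub_klLeadingAtWindowDoping`          — rev c5-3: blocked-on stmt-1741 (clause (i)); rev c7-1: a THEOREM from (P1)(P2)(P3);
* (M)   `stub_dWaveOrderFloorOnLeadingWindows`  — RESEARCH, registered for PROMOTION: the Kohn–Luttinger mechanism in local uniform
  form (γU²-leading on a level window ⊂ [-2,-3/10] ⇒ floor e^{-C/U²} on [μ₁+U/2, μ₂] for all small U); the sibling's merged stub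
  `stub_dWaveOrderFloorOnWindow` (stmt-2010 rev c3-1) is its instance (`siblingFloor_of_leadingWindows`).
Closed this seat (wired in below): (Kwin) `stub_klLeadingMuWindowOfPoint` p141740 (lead), (F2) `stub_fillingAtNegThreeTenths` p141417,
(Gw) `stub_ladderShellGeometryWide` p141478 (wave-1 workers), transfer `stub_cruxOfOrderFloorOnCertifiedLevelWindow` p142268, conditional
bridge `stub_cruxOfChiralWindowAndKLMechanism` p142734 (`CwKLChiralWindow ∧ (KL mechanism, sub-window form) ⟹ crux`, record-free).
rev c5-1/c5-2 had (M) cut into (Rloc) `SymmetricFlowToLadderScaleLocal` + (B) `BrokenRegimeAtLadderScale` along the v3 certificate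
`SymmetricCertifiedAtT`; the sibling lead 2010-c3's interface audit (R1B-interface-leak.md) shows that cut leaks ((B) ⊇ fine (Rloc)), so
rev c5-3 registers (M) and keeps the pair as the kernel-checked refinement `dWaveOrderFloorOnLeadingWindows_of_certificateChain`.
Proved in-file: (F1) `n(-2) ≤ 1/2`; the two feeds of (Kpt); `siblingFloor_of_leadingWindows`; `siblingCore_of_local`; the refinement.

## Costume tests (inherited)
No stub bounds a stair from below, none quantifies near-ground states or seeds; (M) is an order floor UNIFORM on a level window
under an explicit KL-leading hypothesis (by `BottomStairCostume.dbf_iff`-type bookkeeping it is "bottom stairs uniform on a box" —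
census S⁺ — and is registered AS crux-sized, for promotion); (Kpt)/(Kwin)/(F2)/(Gw) are Kohn–Luttinger / free-band facts. Neither
stub is implied by the crux (uniformity in the window; the crux fixes no window and asks one `μ` per `U`); together they imply it
(`CwChiralConstruction_of`).

## Disproof used (`Cruxes/CwChiralConstruction/Disproof.lean`, cycle-2 final, mtime 2026-08-16T06:35Z, re-read 2026-08-17T03:55Z)
No `-- Targets`, no `_false_without_`. §B: (B) concludes on `dWaveOrderParameter` itself (source on, punctured filter).
§D/§G: the floor is `e^{-(C₁+1)/U²}` on the OPEN interval `(0, U₀)`; no certificate at `U = 0`. §C ceiling imported as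
`ceiling_anchor`. §F: the window produced by (Kwin) has free fillings in `(13/25, 7/10)`, inside the pinned range. §H: the
census has `B₁g` leading down to `n* ≈ 0.588` (`δ* ≈ 0.41`), so (Kpt) at `δ₀ ∈ [0.30, 0.41)` is folklore-true.
-/

set_option linter.dupNamespace false

namespace Summit.HubbardSuperconductivity.HubbardSuperconductivity.Cruxes.CwChiralConstruction.LadderScaleTransfer

open MeasureTheory Literature.MathematicalPhysics.QuantumLattice Literature.Probability.LatticeModels Matrix Filter
open Summit.HubbardSuperconductivity.HubbardSuperconductivity.Theses.ChiralWindow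
open Summit.HubbardSuperconductivity.HubbardSuperconductivity.Theorems
open scoped Topology

/-! ### The shared weak-coupling record (VERBATIM copy of the sibling line's `ladderScaleData` / `ladderTolerance`,
rev c2-3 — `frameDecay := 0`) -/

/-- **Ladder-scale physical data** `π(s)` — byte-for-byte the record of
`Cruxes/WcbcsBcsConstruction/Lines/ladder_scale_certified_chain.lean` (rev c2-3: `frameDecay := 0`): scale range
`[s, 2s]`, frameBound `10`, quarticBound `8`, stonerMargin `1/4`, fieldFloor `1/2`, Fermi speed in `[1/2, 4]`,
level-curvature in `[1/25, 3]`, van Hove distance `1/2`, remainderBound `32`, fieldRadius `1/4`, slopeAllowance `1/2`,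
remainderDegree `10`. [cite: Salmhofer1998, §4.1–4.2 Thm. 1] -/
def ladderScaleData (s : ℚ) (hs : 0 < s) : SymmetricRegimeDataT where
  frameBound := 10
  quarticBound := 8
  quarticBound_pos := by norm_num
  stonerMargin := 1 / 4
  stonerMargin_pos := by norm_num
  stonerMargin_lt_one := by norm_num
  fieldFloor := 1 / 2
  fieldFloor_pos := by norm_num
  fieldFloor_le_one := by norm_num
  velLower := 1 / 2
  velUpper := 4
  velLower_pos := by norm_num
  velLower_le := by norm_num
  curvLower := 1 / 25
  curvUpper := 3
  curvLower_pos := by norm_num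
  curvLower_le := by norm_num
  vanHoveDist := 1 / 2
  vanHoveDist_pos := by norm_num
  scaleLower := s
  scaleUpper := 2 * s
  scaleLower_pos := hs
  scaleLower_le := by linarith
  frameDecay := 0
  remainderBound := 32
  remainderBound_pos := by norm_num
  fieldRadius := 1 / 4
  fieldRadius_pos := by norm_num
  fieldRadius_le_one := by norm_num
  slopeAllowance := 1 / 2
  slopeAllowance_nonneg := by norm_num
  remainderDegree := 10

/-- The scale range of `π(s)` is `[s, 2s]`. [folklore] -/
@[simp] theorem ladderScaleData_scaleLower (s : ℚ) (hs : 0 < s) : (ladderScaleData s hs).scaleLower = s := rfl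

/-- The scale range of `π(s)` is `[s, 2s]`. [folklore] -/
@[simp] theorem ladderScaleData_scaleUpper (s : ℚ) (hs : 0 < s) : (ladderScaleData s hs).scaleUpper = 2 * s := rfl

/-- **The ladder-scale tolerance** `Θ_I = (1/4, 1/20)` — byte-for-byte the sibling line's `ladderTolerance`.
[cite: FeldmanSalmhoferTrubowitz1996, §1] -/
def ladderTolerance : SymmetricTolerance where
  mismatch := 1 / 4
  mismatch_pos := by norm_num
  width := 1 / 20
  width_pos := by norm_num

/-! ### (Kpt) `B₁g` leading at ONE window doping — the KL input of this crux, rev c7: from a ONE-POINT `U = 1` certificate -/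

open Summit.HubbardSuperconductivity.HubbardSuperconductivity.Theorems.CwKLChiralWindow in
/-- Stub (P1) — **from a `U = 1` leading inequality at a band level to (Kpt).** If at some `μ ∈ [-111/100, -21/25]` the
`U = 1` channel bottoms satisfy `Λ₁(μ, B1g) + γ ≤ Λ₁(μ, χ)` for every `χ ≠ B1g` (`γ > 0`), then (Kpt) holds at the doping
`δ₀ := 1 - n(μ)`: the LANDED fillings `13/25 ≤ n(-111/100)` (`stub_klFillingLower`, p138691) and `n(-21/25) < 7/10`
(`stub_fillingBelowSevenTenths`, p139953) with `monotone_filling` put `δ₀` in `[3/10, 12/25]`; `chemicalPotentialOfDensity_spec`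
and `strictMonoOn_filling` give `μ(1 - δ₀) = μ`; `CwThesis.leading_of_certificateOne` turns the `U = 1` margin `γ` into `γU²` for
every `U ∈ (0, 1)` (`U²`-homogeneity off `A1g`, bare-`U` penalty for `A1g`). M-sized, provable now.
[cite: RaghuKivelsonScalapino2010, §II (7), (13)] -/
theorem stub_kptOfPointLeading :
    ∀ μ ∈ Set.Icc (-(111:ℝ) / 100) (-(21:ℝ) / 25), ∀ γ : ℝ, 0 < γ →
      (∀ χ : D4Irrep, χ ≠ D4Irrep.B1g →
        channelInf (squareDispersion 1 0) μ 1 D4Irrep.B1g + γ ≤ channelInf (squareDispersion 1 0) μ 1 χ) →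
      ∃ δ₀ ∈ Set.Icc (3/10 : ℝ) (12/25), ∃ γ' U₁ : ℝ, 0 < γ' ∧ 0 < U₁ ∧ ∀ U ∈ Set.Ioo (0:ℝ) U₁,
        ∀ χ : D4Irrep, χ ≠ D4Irrep.B1g →
          channelInf (squareDispersion 1 0) (chemicalPotentialOfDensity (squareDispersion 1 0) (1 - δ₀)) U D4Irrep.B1g
              + γ' * U ^ 2 ≤
            channelInf (squareDispersion 1 0) (chemicalPotentialOfDensity (squareDispersion 1 0) (1 - δ₀)) U χ :=
  -- CLOSED (lead c7, wave 1): landed p146657, `Theorems/ChiralWindowCwChiralConstructionKptOfPointLeading.lean`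
  Summit.HubbardSuperconductivity.HubbardSuperconductivity.Theorems.stub_kptOfPointLeading

open Summit.HubbardSuperconductivity.HubbardSuperconductivity.Theorems.CwKLChiralWindow in
/-- Stub (P2) — **certificate logic for ONE box** (stmt-1741's vocabulary, record-generic). For a box `bx` with table `tab`
whose ends lie in `(-4, 0)`, whose `B1g` block passes the `E_x`-form Temple test, whose four other blocks each pass `lowerOKX`
(Temple data on a trial block or far-channel data `Hhi ≤ s²` on a block without trial) and which passes the rational test
`b1gLeadsOKX tab γ` (`upper_B1g + γ ≤ lowerX_χ` for the four `χ ≠ B1g`): at every level `μ` of the box where the residual-form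
block enclosures E1–E4 hold, `Λ₁(μ, B1g) + γ ≤ Λ₁(μ, χ)` for every `χ ≠ B1g`. Proof: `stub_klBlockBoundsX` (landed) gives
`Λ₁(μ, B1g) ≤ upper_B1g` (Ritz, case `B1g ≠ A1g`) and `lowerX_χ ≤ Λ₁(μ, χ)`; chain with the rational test. S-sized, provable now.
[cite: ReedSimonIV1978, Thm. XIII.5] -/
theorem stub_pointLeadingOfBox :
    ∀ (bx : KLBox) (tab : List KLTrig) (γ : ℚ), -4 < bx.mulo → bx.muhi < 0 →
      bx.bB1g.templeOKX tab D4Irrep.B1g = true →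
      bx.bA1g.lowerOKX tab D4Irrep.A1g = true → bx.bA2g.lowerOKX tab D4Irrep.A2g = true →
      bx.bB2g.lowerOKX tab D4Irrep.B2g = true → bx.bE.lowerOKX tab D4Irrep.E = true →
      bx.b1gLeadsOKX tab γ = true →
      ∀ μ ∈ Set.Icc ((bx.mulo : ℚ) : ℝ) ((bx.muhi : ℚ) : ℝ), (∀ χ : D4Irrep, (bx.blk χ).EnclosureR tab μ χ) →
        ∀ χ : D4Irrep, χ ≠ D4Irrep.B1g →
          channelInf (squareDispersion 1 0) μ 1 D4Irrep.B1g + ((γ : ℚ) : ℝ) ≤ channelInf (squareDispersion 1 0) μ 1 χ :=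
  -- CLOSED (lead c7, wave 1): landed p148296, `Theorems/ChiralWindowCwChiralConstructionPointLeadingOfBox.lean`
  Summit.HubbardSuperconductivity.HubbardSuperconductivity.Theorems.stub_pointLeadingOfBox

open Summit.HubbardSuperconductivity.HubbardSuperconductivity.Theorems.CwKLChiralWindow in
/-- Stub (P3) — **the enclosures of the one-point record `klPtBox` at `μ_pt = -21/25`** (certified COMPUTATION, the only
open piece of the KL input). The record (`Theorems/ChiralWindowDefsPointRecord.lean`, p145573: table `klPtTab` of five
trigonometric polynomials — the `B1g` trial = census bottom state (21 cosine terms `cos(4ℤ+2)θ`), one `B1g`, one `A1g` and one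
quarter-turn pair of `E` deflation vectors — and the one-box `KLBox` literal `klPtBox`, Booleans decided by `klPt_okX`) asks, at the
single level `μ = -21/25`, for the residual-form enclosures E1–E4 (`KLBlock.EnclosureR`) of its five blocks: for the `B1g` trial `Φ`:
`999/1000 ≤ ∫Φ² dσ ≤ 1001/1000` (float `0.99999`), `-3/40 ≤ ∫Φ(χ₀Φ) ≤ -29/500` (float `-0.064713`), `∫(χ₀Φ - sΦ)² ≤ 1/5000` with
`s = -647/10000` (float `3e-8`), `∫∫(K_B1g - c u⊗u)² ≤ 3/500` (float `4.27e-3`); and the deflated sector square masses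
`∫∫(K_χ - Σ c u⊗u)² ≤ 3/1000` for `A1g` (float `2.84e-4`, one vector), `A2g` (`7.90e-4`, raw), `B2g` (`7.47e-4`, raw), `E` (`1.46e-3`, one
pair) — ten inequalities, the tightest with ×1.4 room; a certified kernel width `δ_A ≈ 1e-3` on `√w χ₀ √w'` closes all of them
(stmt-1741's boxes need `1e-5`). Target doc: `Cruxes/CwChiralConstruction/PointCertTarget.md`. [cite: RaghuKivelsonScalapino2010, §III Fig. 2] -/
theorem stub_klPointEnclosure : ∀ χ : D4Irrep, (klPtBox.blk χ).EnclosureR klPtTab (-(21:ℝ) / 25) χ := by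
  sorry

open Summit.HubbardSuperconductivity.HubbardSuperconductivity.Theorems.CwKLChiralWindow in
/-- (P3, `∃ record` form of rev c7-1, registered) — **the one-point certificate at `μ_pt = -21/25`**, now WITNESSED by the
concrete record: `klPtBox`, `klPtTab`, `klPtGamma = 1/500` with the kernel decision `klPt_okX` (p145573) and the enclosure stub
`stub_klPointEnclosure` (rev c7-1 registered this `∃ record` form before the literal existed; kept as the registered interface:
a one-box record `[μ_pt, μ_pt]` whose `B1g` trial block passes `templeOKX`, whose `A1g`/`A2g`/`B2g`/`E` blocks pass `lowerOKX`, which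
passes `b1gLeadsOKX tab γ` with `γ > 0`, and whose residual-form enclosures E1–E4 hold at `μ_pt`). [cite: RaghuKivelsonScalapino2010, §III Fig. 2] -/
theorem stub_klPointCertificate :
    ∃ (bx : KLBox) (tab : List KLTrig) (γ : ℚ), 0 < γ ∧ bx.mulo = -21 / 25 ∧ bx.muhi = -21 / 25 ∧
      bx.bB1g.templeOKX tab D4Irrep.B1g = true ∧
      bx.bA1g.lowerOKX tab D4Irrep.A1g = true ∧ bx.bA2g.lowerOKX tab D4Irrep.A2g = true ∧
      bx.bB2g.lowerOKX tab D4Irrep.B2g = true ∧ bx.bE.lowerOKX tab D4Irrep.E = true ∧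
      bx.b1gLeadsOKX tab γ = true ∧
      ∀ χ : D4Irrep, (bx.blk χ).EnclosureR tab (-(21:ℝ) / 25) χ := by
  obtain ⟨hγ, hlo, hhi, htB, hA1, hA2, hB2, hE, hlead⟩ := klPt_okX
  exact ⟨klPtBox, klPtTab, klPtGamma, hγ, hlo, hhi, htB, hA1, hA2, hB2, hE, hlead, stub_klPointEnclosure⟩

open Summit.HubbardSuperconductivity.HubbardSuperconductivity.Theorems.CwKLChiralWindow in
/-- **(Kpt), now a theorem of the skeleton** (statement byte-identical to the registered stub of rev c5-3): the one-point
certificate (P3), read through the box logic (P2) at `μ_pt = -21/25`, is a `U = 1` leading inequality at a band level in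
`[-111/100, -21/25]`, which (P1) turns into (Kpt). [cite: RaghuKivelsonScalapino2010, §III Fig. 2] -/
theorem stub_klLeadingAtWindowDoping :
    ∃ δ₀ ∈ Set.Icc (3/10 : ℝ) (12/25), ∃ γ U₁ : ℝ, 0 < γ ∧ 0 < U₁ ∧ ∀ U ∈ Set.Ioo (0:ℝ) U₁,
      ∀ χ : D4Irrep, χ ≠ D4Irrep.B1g →
        channelInf (squareDispersion 1 0) (chemicalPotentialOfDensity (squareDispersion 1 0) (1 - δ₀)) U D4Irrep.B1g
            + γ * U ^ 2 ≤
          channelInf (squareDispersion 1 0) (chemicalPotentialOfDensity (squareDispersion 1 0) (1 - δ₀)) U χ := by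
  obtain ⟨bx, tab, γ, hγ, hlo, hhi, htB, hA1, hA2, hB2, hE, hlead, hencl⟩ := stub_klPointCertificate
  have hlo' : ((bx.mulo : ℚ) : ℝ) = -(21:ℝ) / 25 := by rw [hlo]; push_cast; ring
  have hhi' : ((bx.muhi : ℚ) : ℝ) = -(21:ℝ) / 25 := by rw [hhi]; push_cast; ring
  have hpt := stub_pointLeadingOfBox bx tab γ (by rw [hlo]; norm_num) (by rw [hhi]; norm_num) htB hA1 hA2 hB2 hE hlead
    (-(21:ℝ) / 25) ⟨le_of_eq hlo', le_of_eq hhi'.symm⟩ hencl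
  exact stub_kptOfPointLeading (-(21:ℝ) / 25) ⟨by norm_num, le_rfl⟩ ((γ : ℚ) : ℝ) (by exact_mod_cast hγ) hpt

/-- **(Kpt) from the kill switch**: clause (i) of `CwKLChiralWindow` (stmt-1741) is (Kpt) at `δ₀ := a`.
[cite: RaghuKivelsonScalapino2010, §III Fig. 2] -/
theorem klLeadingAtWindowDoping_of_cwKLChiralWindow (h : CwKLChiralWindow) :
    ∃ δ₀ ∈ Set.Icc (3/10 : ℝ) (12/25), ∃ γ U₁ : ℝ, 0 < γ ∧ 0 < U₁ ∧ ∀ U ∈ Set.Ioo (0:ℝ) U₁,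
      ∀ χ : D4Irrep, χ ≠ D4Irrep.B1g →
        channelInf (squareDispersion 1 0) (chemicalPotentialOfDensity (squareDispersion 1 0) (1 - δ₀)) U D4Irrep.B1g
            + γ * U ^ 2 ≤
          channelInf (squareDispersion 1 0) (chemicalPotentialOfDensity (squareDispersion 1 0) (1 - δ₀)) U χ := by
  obtain ⟨_, _, _, a, b, γ, _, U₁, ha, hab, hb, hγ, _, hU₁, H⟩ := h
  refine ⟨a, ⟨ha, by linarith⟩, γ, U₁, hγ, hU₁, fun U hU χ hχ => ?_⟩
  obtain ⟨h1, -⟩ := H U hU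
  exact h1 χ hχ

/-! ### (Kwin) From the point to a level window — THIS SEAT'S STUB (CLOSED p141740) -/

/-- Stub (Kwin) — **from `B₁g` leading at one window doping to `B₁g` leading on a level window with certified
fillings** (M; this seat; CLOSED p141740). If (Kpt) holds at `δ₀` with margin `γ` below `U₁`, then there are band levels
`-4 < μ₁ < μ₂ < 0` with free fillings `13/25 < n(μ₁)`, `n(μ₂) < 7/10` and `γ', U₁' > 0` such that `B₁g` leads every
other channel by `γ'U²` at EVERY `μ ∈ [μ₁, μ₂]` and every `U ∈ (0, U₁')`. Mechanism: for `χ ≠ A1g` the bottoms are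
exactly `U² Λ_1(μ,χ)` (`channelInf_sq_of_ne_A1g`), so the datum at `U₁/2` is a `U`-free strict inequality at `δ₀`,
spread to a `δ`-window by the continuity of `δ ↦ Λ_1(μ(1-δ), χ)` on `[1/4,12/25]` (`CwChannelInfContinuous`, stmt-1744,
PROVED); for `A1g`, `Λ_U(μ,A1g)/U²` is antitone in `U` (the pairing form is `U(∫ψ)² + U²Q(ψ)`), so the inequality at
`U' = U₁/2`, spread in `δ` by continuity at `U'`, holds for all `U ≤ U'`; the `δ`-window (one-sided at the ends of
`[3/10, 12/25]`) is read as a `μ`-window through the continuous strictly monotone free filling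
(`chemicalPotentialOfDensity_spec`, `strictMonoOn_filling`). [cite: RaghuKivelsonScalapino2010, §II (7), (13)] -/
theorem stub_klLeadingMuWindowOfPoint :
    (∃ δ₀ ∈ Set.Icc (3/10 : ℝ) (12/25), ∃ γ U₁ : ℝ, 0 < γ ∧ 0 < U₁ ∧ ∀ U ∈ Set.Ioo (0:ℝ) U₁,
      ∀ χ : D4Irrep, χ ≠ D4Irrep.B1g →
        channelInf (squareDispersion 1 0) (chemicalPotentialOfDensity (squareDispersion 1 0) (1 - δ₀)) U D4Irrep.B1g
            + γ * U ^ 2 ≤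
          channelInf (squareDispersion 1 0) (chemicalPotentialOfDensity (squareDispersion 1 0) (1 - δ₀)) U χ) →
    ∃ μ₁ μ₂ γ U₁ : ℝ, -4 < μ₁ ∧ μ₁ < μ₂ ∧ μ₂ < 0 ∧ 0 < γ ∧ 0 < U₁ ∧
      13 / 25 < KohnLuttinger.filling (squareDispersion 1 0) μ₁ ∧
      KohnLuttinger.filling (squareDispersion 1 0) μ₂ < 7 / 10 ∧
      ∀ U ∈ Set.Ioo (0:ℝ) U₁, ∀ μ ∈ Set.Icc μ₁ μ₂, ∀ χ : D4Irrep, χ ≠ D4Irrep.B1g →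
        channelInf (squareDispersion 1 0) μ U D4Irrep.B1g + γ * U ^ 2 ≤ channelInf (squareDispersion 1 0) μ U χ :=
  -- CLOSED (lead c5, cycle 1): landed p141740, `Theorems/ChiralWindowCwChiralConstructionKLWindowOfPoint.lean`
  Summit.HubbardSuperconductivity.HubbardSuperconductivity.Theorems.stub_klLeadingMuWindowOfPoint

/-! ### (F1), (F2) Two certified free fillings placing the level window inside `[-2, -3/10]` -/

/-- (F1) — **the free filling at `μ = -2` is at most `1/2`** (true value `0.37`): the Fermi sea
`{cos x + cos y > 1}` lies in the open square `(-π/2, π/2)²` (`cos x > 1 - cos y ≥ 0` forces `|x| < π/2` on `[-π, π]`),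
of area `π²`, so `n(-2) = 2·vol/(2π)² ≤ 1/2`. [folklore] -/
theorem filling_neg_two_le_half : KohnLuttinger.filling (squareDispersion 1 0) (-2) ≤ 1 / 2 := by
  rw [kl_mu_filling_eq]
  have hsub : {p : Momentum | squareDispersion 1 0 p < -2} ∩ brillouinZone ⊆
      {p : Momentum | ∀ i, p i ∈ Set.Ioo (-(Real.pi / 2)) (Real.pi / 2)} := by
    rintro p ⟨hp1, hp2⟩
    simp only [Set.mem_setOf_eq, squareDispersion] at hp1
    have hsum : 1 < Real.cos (p 0) + Real.cos (p 1) := by linarith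
    have habs : ∀ i, |p i| ≤ Real.pi := fun i => by
      have := hp2 i
      rw [abs_le]
      exact ⟨this.1, this.2.le⟩
    have hcos : ∀ i, 0 < Real.cos (p i) := by
      intro i
      fin_cases i
      · have := Real.cos_le_one (p 1); simp; linarith
      · have := Real.cos_le_one (p 0); simp; linarith
    intro i
    have hlt : |p i| < Real.pi / 2 := by
      by_contra hge
      have hge : Real.pi / 2 ≤ |p i| := not_lt.mp hge
      have h1 : Real.cos |p i| ≤ Real.cos (Real.pi / 2) :=
        Real.cos_le_cos_of_nonneg_of_le_pi (by positivity) (habs i) hge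
      rw [Real.cos_abs, Real.cos_pi_div_two] at h1
      linarith [hcos i]
    exact ⟨by linarith [(abs_lt.1 hlt).1], (abs_lt.1 hlt).2⟩
  have hvol : (volume ({p : Momentum | squareDispersion 1 0 p < -2} ∩ brillouinZone)).toReal ≤ Real.pi ^ 2 := by
    refine ENNReal.toReal_le_of_le_ofReal (by positivity) ?_
    exact (measure_mono hsub).trans (le_of_eq volume_halfOpenSquare)
  have hπ : 0 < Real.pi := Real.pi_pos
  rw [div_le_iff₀ (by positivity)]
  nlinarith

/-- Stub (F2) — **the free filling at `μ = -3/10` is at least `7/10`** (M; CLOSED by the wave-1 worker, p141417; true value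
`0.8487`): the Fermi sea `{cos x + cos y > 3/20}` contains the disc `B(0, 21/10)` (Taylor-6 minorant of `cos`), of area
`4.41π`, so `n(-3/10) ≥ 4.41/(2π) ≥ 7/10` (`π < 3.15`). Why here: `-3/10` is the top of the level range of the record
(van Hove distance `1/2`) and of the sibling's (K1) window. [folklore] -/
theorem stub_fillingAtNegThreeTenths :
    7 / 10 ≤ KohnLuttinger.filling (squareDispersion 1 0) (-(3:ℝ) / 10) :=
  -- CLOSED (lead c5, cycle 1, wave 1): landed p141417,
  -- `Theorems/ChiralWindowCwChiralConstructionFillingAtNegThreeTenths.lean` (inscribed disc `B(0, 21/10)`, `4.41/(2π) ≥ 7/10`)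
  Summit.HubbardSuperconductivity.HubbardSuperconductivity.Theorems.stub_fillingAtNegThreeTenths

/-- **(Kpt) from the sibling's (K1)** (documentation of the second feed): the `U = 1` window certificate on
`μ ∈ [-9/10, -3/10]` gives (Kpt) at `δ₀ := 3/10`, since `μ(7/10) ∈ [-9/10, -3/10]`
(`n(-9/10) ≤ n(-21/25) < 7/10 ≤ n(-3/10)`: (T) p139953, (F2), `strictMonoOn_filling`) and the `U = 1` margin is a
`γU²` margin for every `U ∈ (0,1)` (`CwThesis.leading_of_certificateOne`). [cite: RaghuKivelsonScalapino2010, §III] -/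
theorem klLeadingAtWindowDoping_of_K1 (hF2 : 7 / 10 ≤ KohnLuttinger.filling (squareDispersion 1 0) (-(3:ℝ) / 10))
    (hK1 : ∃ γ : ℝ, 0 < γ ∧ ∀ μ ∈ Set.Icc (-(9:ℝ) / 10) (-(3:ℝ) / 10), ∀ χ : D4Irrep, χ ≠ D4Irrep.B1g →
      channelInf (squareDispersion 1 0) μ 1 D4Irrep.B1g + γ ≤ channelInf (squareDispersion 1 0) μ 1 χ) :
    ∃ δ₀ ∈ Set.Icc (3/10 : ℝ) (12/25), ∃ γ U₁ : ℝ, 0 < γ ∧ 0 < U₁ ∧ ∀ U ∈ Set.Ioo (0:ℝ) U₁,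
      ∀ χ : D4Irrep, χ ≠ D4Irrep.B1g →
        channelInf (squareDispersion 1 0) (chemicalPotentialOfDensity (squareDispersion 1 0) (1 - δ₀)) U D4Irrep.B1g
            + γ * U ^ 2 ≤
          channelInf (squareDispersion 1 0) (chemicalPotentialOfDensity (squareDispersion 1 0) (1 - δ₀)) U χ := by
  obtain ⟨γ, hγ, hK⟩ := hK1
  have hδ₀ : (3/10 : ℝ) ∈ Set.Icc (3/10 : ℝ) (12/25) := ⟨le_rfl, by norm_num⟩
  have hδw : (3/10 : ℝ) ∈ Set.Icc (1/4 : ℝ) (12/25) := ⟨by norm_num, by norm_num⟩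
  set m := chemicalPotentialOfDensity (squareDispersion 1 0) (1 - 3/10) with hm
  have hwin := one_sub_mem_Ioo_of_mem_window hδw
  obtain ⟨hmI, hfill⟩ := chemicalPotentialOfDensity_spec hwin.1 hwin.2
  -- locate `m` in `[-9/10, -3/10]` by the strictly monotone filling
  have hm_lo : -(9:ℝ) / 10 ≤ m := by
    by_contra hlt
    have hlt : m < -(9:ℝ) / 10 := not_le.mp hlt
    have h1 : KohnLuttinger.filling (squareDispersion 1 0) m <
        KohnLuttinger.filling (squareDispersion 1 0) (-(9:ℝ) / 10) :=
      strictMonoOn_filling ⟨hmI.1.le, by linarith [hmI.2]⟩ (by constructor <;> norm_num) hlt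
    have h2 : KohnLuttinger.filling (squareDispersion 1 0) (-(9:ℝ) / 10) ≤
        KohnLuttinger.filling (squareDispersion 1 0) (-(21:ℝ) / 25) := monotone_filling (by norm_num)
    have h3 := stub_fillingBelowSevenTenths
    rw [hfill] at h1
    linarith
  have hm_hi : m ≤ -(3:ℝ) / 10 := by
    by_contra hlt
    have hlt : -(3:ℝ) / 10 < m := not_le.mp hlt
    have h1 : KohnLuttinger.filling (squareDispersion 1 0) (-(3:ℝ) / 10) <
        KohnLuttinger.filling (squareDispersion 1 0) m :=
      strictMonoOn_filling (by constructor <;> norm_num) ⟨hmI.1.le, by linarith [hmI.2]⟩ hlt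
    rw [hfill] at h1
    linarith
  refine ⟨3/10, hδ₀, γ, 1, hγ, one_pos, fun U hU χ hχ => ?_⟩
  exact CwThesis.leading_of_certificateOne hmI (hK m ⟨hm_lo, hm_hi⟩) U hU χ hχ

/-! ### (Gw) Shell geometry of the record on the wide level range — CLOSED p141478 -/

/-- Stub (Gw) — **shell geometry of the ladder-scale record on the level range `ν ∈ [-2, -3/10]`** (M; CLOSED by the
wave-1 worker, p141478):
for every such `ν`, every frame `K` with `|K|, |∂K|, |∂²K| ≤ 1/500` pointwise and every `Λ ≤ 1/50`,
`ShellGeometry (renormalisedBandC ν K) Λ (1/2) 4 (1/25) 3 (1/2)`. The sibling's `stub_ladderShellGeometryFn`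
(p138830) is the case `ν ∈ [-9/10,-3/10]`; its proof (`shell_jet_bounds` on `S = cos p₀ + cos p₁ ∈ [0.139, 0.461]`,
`vanHove_dist_of_level`) extends to `S ∈ [0.139, 1.011]`: `G = 4(2 - S² + 2P) ∈ [4S(2-S) - O(1/50), 8]`,
`N = 8S(1-P) > 0`, `N² ≤ 9G³`, `G³ ≤ 625N²` there. [cite: FeldmanKnorrerTrubowitz2004, §1] -/
theorem stub_ladderShellGeometryWide :
    ∀ ν ∈ Set.Icc (-(2:ℝ)) (-(3:ℝ) / 10), ∀ K : TrigPolyC4v,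
      (∀ p : Fin 2 → ℝ, |K.eval p| ≤ 1 / 500 ∧ |partialD 0 K.eval p| ≤ 1 / 500 ∧ |partialD 1 K.eval p| ≤ 1 / 500 ∧
        |partialD 0 (partialD 0 K.eval) p| ≤ 1 / 500 ∧ |partialD 0 (partialD 1 K.eval) p| ≤ 1 / 500 ∧
        |partialD 1 (partialD 1 K.eval) p| ≤ 1 / 500) →
      ∀ Λ : ℝ, Λ ≤ 1 / 50 → ShellGeometry (renormalisedBandC ν K) Λ (1 / 2) 4 (1 / 25) 3 (1 / 2) :=
  -- CLOSED (lead c5, cycle 1, wave 1): landed p141478, `Theorems/ChiralWindowCwChiralConstructionLadderShellGeometryWide.lean`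
  Summit.HubbardSuperconductivity.HubbardSuperconductivity.Theorems.stub_ladderShellGeometryWide

/-! ### (M) The Kohn–Luttinger mechanism, local uniform form — THE research stub (registered for PROMOTION) -/

/-- Stub (M) — **the Kohn–Luttinger mechanism in local uniform form** (XL; OPEN RESEARCH = the weak-coupling constructive
programme, symmetric AND broken regime; registered for PROMOTION, not for a worker). For every level window
`[μ₁, μ₂] ⊂ [-2, -3/10]` on which `B₁g` leads every other channel of the second-order vertex by `γU²` for all `U < U₁`, there are
`U₀, C > 0` with `e^{-C/U²} ≤ dWaveOrderParameter U μ` for every `U ∈ (0, U₀)` and every operator level `μ ∈ [μ₁ + U/2, μ₂]`.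
Why ONE stub and not the pair (Rloc)+(B) of rev c5-1/c5-2: the sibling lead 2010-c3's interface audit
(`Cruxes/WcbcsBcsConstruction/R1B-interface-leak.md`, 2026-08-17T04:07Z) shows the v3 certificate `SymmetricCertifiedAtT` exports only
momentum-space sup norms of the kernels of degree `≤ 10` plus shell spectral data — not an all-degree, field-radius, sectorised
`L¹–L^∞` ball — so the broken-regime prover of (B) must redo the symmetric flow in fine norms: (B) ⊇ (fine Rloc) ∘ (broken regime);
the certificate does not CUT the programme. The pair is kept below as a documented REFINEMENT (`…_of_certificateChain`, kernel-checked,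
(Gw) landed), exactly as the sibling keeps (R1)/(B) under its merged stub (M). SHARING: the sibling's
`stub_dWaveOrderFloorOnWindow : (K1) → floor on [-21/25, -7/20]` is the instance `[μ₁, μ₂] = [-9/10, -3/10]` of THIS stub
(`siblingFloor_of_leadingWindows`, proved below; `U ≤ 3/25`) — one promoted item serves both cruxes. MECHANISM (intended proof):
multiscale fermionic RG in the symmetric regime (BGM2006 above `e^{-a/U}`, then irrep-resolved Cooper flow with the `B₁g` ladder fed
by `γU²` and stopped at `λ_d ≍ 1/8` at a ladder scale `s ≥ e^{-C₁/U²}`), then the `h`-seeded broken-regime expansion below the ladder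
scale (large-`N` BCS, FMRT 1993), `m ≈ ρ_d Δ log(Λ/Δ) ≥ c·s ≥ e^{-(C₁+1)/U²}`. Why it might fail: no construction controls a
symmetric 2D Fermi surface below `T ≍ e^{-a/|U|}` (barrier `WeakCouplingCeiling`), and no constructive control of continuous `U(1)`
breaking with a Goldstone mode exists for any short-range Fermi-surface model (`PerturbativeInvisibilityOfPairing` is evaded only in
the sense that the floor is produced below a certified scale, never read off perturbatively). NOT implied by the crux (uniform in the
window, explicit KL hypothesis); with (Kpt) it implies the crux (`CwChiralConstruction_of`). [cite: KohnLuttinger1965]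
[cite: BenfattoGiulianiMastropietro2006, Theorem 1.1] [cite: FeldmanKnorrerTrubowitz2004, §1] [cite: KomaTasaki1994, §1] -/
theorem stub_dWaveOrderFloorOnLeadingWindows :
    ∀ μ₁ μ₂ γ U₁ : ℝ, -2 ≤ μ₁ → μ₁ < μ₂ → μ₂ ≤ -(3:ℝ) / 10 → 0 < γ → 0 < U₁ →
      (∀ U ∈ Set.Ioo (0:ℝ) U₁, ∀ μ ∈ Set.Icc μ₁ μ₂, ∀ χ : D4Irrep, χ ≠ D4Irrep.B1g →
        channelInf (squareDispersion 1 0) μ U D4Irrep.B1g + γ * U ^ 2 ≤ channelInf (squareDispersion 1 0) μ U χ) →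
      ∃ U₀ C : ℝ, 0 < U₀ ∧ 0 < C ∧ ∀ U ∈ Set.Ioo (0:ℝ) U₀, ∀ μ ∈ Set.Icc (μ₁ + U / 2) μ₂,
        Real.exp (-C / U ^ 2) ≤ dWaveOrderParameter U μ := by
  sorry

/-- **The sibling's merged stub is an instance.** From (M) at `[μ₁, μ₂] = [-9/10, -3/10]` and the landed reduction
`U = 1 ⇒ γU² (U < 1)` (`CwThesis.leading_of_certificateOne`), the VERBATIM conclusion of crux stmt-2010's `stub_dWaveOrderFloorOnWindow`
(rev c3-1: `(K1) → ∃ U₀ C > 0, ∀ U ∈ (0,U₀), ∀ μ ∈ [-21/25, -7/20], e^{-C/U²} ≤ dWaveOrderParameter U μ`) follows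
(`[-21/25, -7/20] ⊂ [-9/10 + U/2, -3/10]` for `U ≤ 3/25`). [cite: KohnLuttinger1965] -/
theorem siblingFloor_of_leadingWindows
    (hM : ∀ μ₁ μ₂ γ U₁ : ℝ, -2 ≤ μ₁ → μ₁ < μ₂ → μ₂ ≤ -(3:ℝ) / 10 → 0 < γ → 0 < U₁ →
      (∀ U ∈ Set.Ioo (0:ℝ) U₁, ∀ μ ∈ Set.Icc μ₁ μ₂, ∀ χ : D4Irrep, χ ≠ D4Irrep.B1g →
        channelInf (squareDispersion 1 0) μ U D4Irrep.B1g + γ * U ^ 2 ≤ channelInf (squareDispersion 1 0) μ U χ) →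
      ∃ U₀ C : ℝ, 0 < U₀ ∧ 0 < C ∧ ∀ U ∈ Set.Ioo (0:ℝ) U₀, ∀ μ ∈ Set.Icc (μ₁ + U / 2) μ₂,
        Real.exp (-C / U ^ 2) ≤ dWaveOrderParameter U μ)
    (hK1 : ∃ γ : ℝ, 0 < γ ∧ ∀ μ ∈ Set.Icc (-(9:ℝ) / 10) (-(3:ℝ) / 10), ∀ χ : D4Irrep, χ ≠ D4Irrep.B1g →
      channelInf (squareDispersion 1 0) μ 1 D4Irrep.B1g + γ ≤ channelInf (squareDispersion 1 0) μ 1 χ) :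
    ∃ U₀ C : ℝ, 0 < U₀ ∧ 0 < C ∧ ∀ U ∈ Set.Ioo (0:ℝ) U₀, ∀ μ ∈ Set.Icc (-(21:ℝ) / 25) (-(7:ℝ) / 20),
      Real.exp (-C / U ^ 2) ≤ dWaveOrderParameter U μ := by
  obtain ⟨γ, hγ, hK⟩ := hK1
  have hKγ : ∀ U ∈ Set.Ioo (0:ℝ) 1, ∀ μ ∈ Set.Icc (-(9:ℝ) / 10) (-(3:ℝ) / 10), ∀ χ : D4Irrep, χ ≠ D4Irrep.B1g →
      channelInf (squareDispersion 1 0) μ U D4Irrep.B1g + γ * U ^ 2 ≤ channelInf (squareDispersion 1 0) μ U χ := by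
    intro U hU μ hμ χ hχ
    have hμI : μ ∈ Set.Ioo (-4 : ℝ) 0 := ⟨by linarith [hμ.1], by linarith [hμ.2]⟩
    exact CwThesis.leading_of_certificateOne hμI (hK μ hμ) U hU χ hχ
  obtain ⟨U₀, C, hU₀, hC, H⟩ := hM (-(9:ℝ) / 10) (-(3:ℝ) / 10) γ 1 (by norm_num) (by norm_num) le_rfl hγ one_pos hKγ
  refine ⟨min U₀ (3 / 25), C, lt_min hU₀ (by norm_num), hC, fun U hU μ hμ => ?_⟩
  have hUU₀ : U < U₀ := lt_of_lt_of_le hU.2 (min_le_left _ _)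
  have hU325 : U < 3 / 25 := lt_of_lt_of_le hU.2 (min_le_right _ _)
  exact H U ⟨hU.1, hUU₀⟩ μ ⟨by linarith [hμ.1], by linarith [hμ.2]⟩

/-! ### The documented refinement of (M): the certificate chain (Rloc) + (Gw, landed) + (B) — NOT registered (see the leak note) -/

/-- (Rloc) — **the symmetric flow to the ladder scale, thermodynamic block, LOCAL in the level** (statement only; XL research;
generalises the sibling's (R1) = the instance `[-9/10, -3/10]`, `siblingCore_of_local`). For every level window
`[μ₁, μ₂] ⊂ [-2, -3/10]` with `γU²`-leading for `U < U₁`: `U₀, C₁ > 0` such that every `U ∈ (0, U₀)` and every GRASSMANN level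
`ν ∈ [μ₁, μ₂ - U/2]` admit a rational scale `e^{-C₁/U²} ≤ s ≤ 1/100`, a `C²`-small frame `K` in the record's `ℓ¹` class, a scale
`Λ ∈ [s, 2s]`, `L₀` and one enclosure `1/8 ≤ a ≤ b ≤ 1/5`, `b - a ≤ 1/20`, with `hubbardEffectiveActionCT L M β U ν 0 K Λ`
`SymmetricCertifiedAtT (ladderScaleData s hs) ladderTolerance a b` for all `L ≥ L₀`, eventually in `β`, `M`. Wave-1 worker (this seat):
`stub-blocked: none in tree` (only `def bgm_two_point_limit : Prop`, the BGM2006 Thm 1.1 shadow at `β ≤ e^{c/|U|}`, `μ < -2-√2`).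
[cite: BenfattoGiulianiMastropietro2006, Theorem 1.1] [cite: Salmhofer1998, §4.2 Thm. 1] [cite: FeldmanSalmhoferTrubowitz1996, §1] -/
def SymmetricFlowToLadderScaleLocal : Prop :=
    ∀ μ₁ μ₂ γ U₁ : ℝ, -2 ≤ μ₁ → μ₁ < μ₂ → μ₂ ≤ -(3:ℝ) / 10 → 0 < γ → 0 < U₁ →
      (∀ U ∈ Set.Ioo (0:ℝ) U₁, ∀ μ ∈ Set.Icc μ₁ μ₂, ∀ χ : D4Irrep, χ ≠ D4Irrep.B1g →
        channelInf (squareDispersion 1 0) μ U D4Irrep.B1g + γ * U ^ 2 ≤ channelInf (squareDispersion 1 0) μ U χ) →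
      ∃ U₀ C₁ : ℝ, 0 < U₀ ∧ 0 < C₁ ∧ ∀ U ∈ Set.Ioo (0:ℝ) U₀, ∀ ν ∈ Set.Icc μ₁ (μ₂ - U / 2),
        ∃ (s : ℚ) (hs : 0 < s), Real.exp (-C₁ / U ^ 2) ≤ (s : ℝ) ∧ (s : ℝ) ≤ 1 / 100 ∧
          ∃ (K : TrigPolyC4v) (Λ : ℝ) (L₀ : ℕ),
            (∀ p : Fin 2 → ℝ, |K.eval p| ≤ 1 / 500 ∧ |partialD 0 K.eval p| ≤ 1 / 500 ∧ |partialD 1 K.eval p| ≤ 1 / 500 ∧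
              |partialD 0 (partialD 0 K.eval) p| ≤ 1 / 500 ∧ |partialD 0 (partialD 1 K.eval) p| ≤ 1 / 500 ∧
              |partialD 1 (partialD 1 K.eval) p| ≤ 1 / 500) ∧
            (ladderScaleData s hs).AdmitsFrameNorm (K.coeffNorm (ladderScaleData s hs).frameDecay) ∧
            (ladderScaleData s hs).AdmitsScale Λ ∧
            ∃ a b : ℚ, symmetricWindowLower ≤ a ∧ a ≤ b ∧ b ≤ symmetricWindowUpper ∧
              b - a ≤ ladderTolerance.width ∧
              ∀ L : ℕ, L₀ ≤ L → ∀ [NeZero L], ∃ β₀ : ℝ, ∀ β : ℝ, β₀ ≤ β → ∃ M₀ : ℕ, ∀ M : ℕ, M₀ ≤ M →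
                ∀ [NeZero M], SymmetricCertifiedAtT (ladderScaleData s hs) ladderTolerance a b Λ L M β
                  (nambuXiCT L ν K) (hubbardEffectiveActionCT L M β U ν 0 K Λ)
                  (hubbardEffPartitionFnCT L M β U ν 0 K Λ)

/-- (B) — **the broken regime at the ladder scale, end to end** (statement only; XL research; VERBATIM the sibling's former
`stub_brokenRegimeAtLadderScale`; sibling wave-1 reply `stub-blocked: AposterioriCapRg 14047 ∘ 13884`; leak: as typed it must redo
(Rloc) in fine norms, see the section header). A research HYPOTHESIS stated for the refinement theorem below — not a
Literature fact, nothing is claimed. [conjecture] [cite: FeldmanKnorrerTrubowitz2004, §1] [cite: KomaTasaki1994, §1] -/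
def BrokenRegimeAtLadderScale : Prop :=
    ∃ c : ℝ, 0 < c ∧ ∀ (s : ℚ) (hs : 0 < s) (U ν : ℝ), U ∈ Set.Ioc (0:ℝ) 1 →
      ∀ (K : TrigPolyC4v) (Λ : ℝ) (L₀ : ℕ),
        symmetricRegimeCertificateT U ν (ladderScaleData s hs) ladderTolerance K Λ L₀ →
          c * (s : ℝ) ≤ dWaveOrderParameter U (ν + U / 2)

/-- **The sibling's (R1) is an instance of (Rloc).** From (Rloc) at `[μ₁, μ₂] = [-9/10, -3/10]` and
`CwThesis.leading_of_certificateOne`, the VERBATIM consequent of crux stmt-2010's former `stub_symmetricFlowToLadderScaleCore`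
(rev c2-3; Grassmann window `[-17/20, -7/20] ⊂ [-9/10, -3/10 - U/2]` for `U ≤ 1/10`). [cite: FeldmanSalmhoferTrubowitz1996, §1] -/
theorem siblingCore_of_local (hR : SymmetricFlowToLadderScaleLocal)
    (hK1 : ∃ γ : ℝ, 0 < γ ∧ ∀ μ ∈ Set.Icc (-(9:ℝ) / 10) (-(3:ℝ) / 10), ∀ χ : D4Irrep, χ ≠ D4Irrep.B1g →
      channelInf (squareDispersion 1 0) μ 1 D4Irrep.B1g + γ ≤ channelInf (squareDispersion 1 0) μ 1 χ) :
    ∃ U₀ C₁ : ℝ, 0 < U₀ ∧ 0 < C₁ ∧ ∀ U ∈ Set.Ioo (0:ℝ) U₀, ∀ ν ∈ Set.Icc (-(17:ℝ) / 20) (-(7:ℝ) / 20),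
      ∃ (s : ℚ) (hs : 0 < s), Real.exp (-C₁ / U ^ 2) ≤ (s : ℝ) ∧ (s : ℝ) ≤ 1 / 100 ∧
        ∃ (K : TrigPolyC4v) (Λ : ℝ) (L₀ : ℕ),
          (∀ p : Fin 2 → ℝ, |K.eval p| ≤ 1 / 500 ∧ |partialD 0 K.eval p| ≤ 1 / 500 ∧ |partialD 1 K.eval p| ≤ 1 / 500 ∧
            |partialD 0 (partialD 0 K.eval) p| ≤ 1 / 500 ∧ |partialD 0 (partialD 1 K.eval) p| ≤ 1 / 500 ∧
            |partialD 1 (partialD 1 K.eval) p| ≤ 1 / 500) ∧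
          (ladderScaleData s hs).AdmitsFrameNorm (K.coeffNorm (ladderScaleData s hs).frameDecay) ∧
          (ladderScaleData s hs).AdmitsScale Λ ∧
          ∃ a b : ℚ, symmetricWindowLower ≤ a ∧ a ≤ b ∧ b ≤ symmetricWindowUpper ∧
            b - a ≤ ladderTolerance.width ∧
            ∀ L : ℕ, L₀ ≤ L → ∀ [NeZero L], ∃ β₀ : ℝ, ∀ β : ℝ, β₀ ≤ β → ∃ M₀ : ℕ, ∀ M : ℕ, M₀ ≤ M →
              ∀ [NeZero M], SymmetricCertifiedAtT (ladderScaleData s hs) ladderTolerance a b Λ L M β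
                (nambuXiCT L ν K) (hubbardEffectiveActionCT L M β U ν 0 K Λ)
                (hubbardEffPartitionFnCT L M β U ν 0 K Λ) := by
  obtain ⟨γ, hγ, hK⟩ := hK1
  have hKγ : ∀ U ∈ Set.Ioo (0:ℝ) 1, ∀ μ ∈ Set.Icc (-(9:ℝ) / 10) (-(3:ℝ) / 10), ∀ χ : D4Irrep, χ ≠ D4Irrep.B1g →
      channelInf (squareDispersion 1 0) μ U D4Irrep.B1g + γ * U ^ 2 ≤ channelInf (squareDispersion 1 0) μ U χ := by
    intro U hU μ hμ χ hχ
    have hμI : μ ∈ Set.Ioo (-4 : ℝ) 0 := ⟨by linarith [hμ.1], by linarith [hμ.2]⟩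
    exact CwThesis.leading_of_certificateOne hμI (hK μ hμ) U hU χ hχ
  obtain ⟨U₀, C₁, hU₀, hC₁, H⟩ := hR (-(9:ℝ) / 10) (-(3:ℝ) / 10) γ 1 (by norm_num) (by norm_num) le_rfl hγ one_pos hKγ
  refine ⟨min U₀ (1 / 10), C₁, lt_min hU₀ (by norm_num), hC₁, fun U hU ν hν => ?_⟩
  have hUU₀ : U < U₀ := lt_of_lt_of_le hU.2 (min_le_left _ _)
  have hU10 : U < 1 / 10 := lt_of_lt_of_le hU.2 (min_le_right _ _)
  exact H U ⟨hU.1, hUU₀⟩ ν ⟨by linarith [hν.1], by linarith [hν.2]⟩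

/-! ### The refinement, kernel-checked: (Rloc) + (Gw) ⟹ full certificates; + (B) ⟹ the floor of (M) -/

/-- **Full ladder-scale certificates on a level window** from (Gw) + (Rloc): the geometry conjunct of
`symmetricRegimeCertificateT` is (Gw) at `Λ ≤ 2s ≤ 1/50`, `ν ∈ [μ₁, μ₂ - U/2] ⊂ [-2, -3/10]`.
[cite: FeldmanSalmhoferTrubowitz1996, §1] -/
theorem certificates_of_local
    (hG : ∀ ν ∈ Set.Icc (-(2:ℝ)) (-(3:ℝ) / 10), ∀ K : TrigPolyC4v,
      (∀ p : Fin 2 → ℝ, |K.eval p| ≤ 1 / 500 ∧ |partialD 0 K.eval p| ≤ 1 / 500 ∧ |partialD 1 K.eval p| ≤ 1 / 500 ∧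
        |partialD 0 (partialD 0 K.eval) p| ≤ 1 / 500 ∧ |partialD 0 (partialD 1 K.eval) p| ≤ 1 / 500 ∧
        |partialD 1 (partialD 1 K.eval) p| ≤ 1 / 500) →
      ∀ Λ : ℝ, Λ ≤ 1 / 50 → ShellGeometry (renormalisedBandC ν K) Λ (1 / 2) 4 (1 / 25) 3 (1 / 2))
    {μ₁ μ₂ : ℝ} (hμ₁ : -2 ≤ μ₁) (hμ₂ : μ₂ ≤ -(3:ℝ) / 10)
    (hR : ∃ U₀ C₁ : ℝ, 0 < U₀ ∧ 0 < C₁ ∧ ∀ U ∈ Set.Ioo (0:ℝ) U₀, ∀ ν ∈ Set.Icc μ₁ (μ₂ - U / 2),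
        ∃ (s : ℚ) (hs : 0 < s), Real.exp (-C₁ / U ^ 2) ≤ (s : ℝ) ∧ (s : ℝ) ≤ 1 / 100 ∧
          ∃ (K : TrigPolyC4v) (Λ : ℝ) (L₀ : ℕ),
            (∀ p : Fin 2 → ℝ, |K.eval p| ≤ 1 / 500 ∧ |partialD 0 K.eval p| ≤ 1 / 500 ∧ |partialD 1 K.eval p| ≤ 1 / 500 ∧
              |partialD 0 (partialD 0 K.eval) p| ≤ 1 / 500 ∧ |partialD 0 (partialD 1 K.eval) p| ≤ 1 / 500 ∧
              |partialD 1 (partialD 1 K.eval) p| ≤ 1 / 500) ∧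
            (ladderScaleData s hs).AdmitsFrameNorm (K.coeffNorm (ladderScaleData s hs).frameDecay) ∧
            (ladderScaleData s hs).AdmitsScale Λ ∧
            ∃ a b : ℚ, symmetricWindowLower ≤ a ∧ a ≤ b ∧ b ≤ symmetricWindowUpper ∧
              b - a ≤ ladderTolerance.width ∧
              ∀ L : ℕ, L₀ ≤ L → ∀ [NeZero L], ∃ β₀ : ℝ, ∀ β : ℝ, β₀ ≤ β → ∃ M₀ : ℕ, ∀ M : ℕ, M₀ ≤ M →
                ∀ [NeZero M], SymmetricCertifiedAtT (ladderScaleData s hs) ladderTolerance a b Λ L M β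
                  (nambuXiCT L ν K) (hubbardEffectiveActionCT L M β U ν 0 K Λ)
                  (hubbardEffPartitionFnCT L M β U ν 0 K Λ)) :
    ∃ U₀ C₁ : ℝ, 0 < U₀ ∧ 0 < C₁ ∧ ∀ U ∈ Set.Ioo (0:ℝ) U₀, ∀ ν ∈ Set.Icc μ₁ (μ₂ - U / 2),
      ∃ (s : ℚ) (hs : 0 < s), Real.exp (-C₁ / U ^ 2) ≤ (s : ℝ) ∧
        ∃ (K : TrigPolyC4v) (Λ : ℝ) (L₀ : ℕ),
          symmetricRegimeCertificateT U ν (ladderScaleData s hs) ladderTolerance K Λ L₀ := by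
  obtain ⟨U₀, C₁, hU₀, hC₁, h⟩ := hR
  refine ⟨U₀, C₁, hU₀, hC₁, fun U hU ν hν => ?_⟩
  obtain ⟨s, hs, hsC, hs100, K, Λ, L₀, hK, hframe, hscale, hblock⟩ := h U hU ν hν
  have hΛ : Λ ≤ 1 / 50 := by
    have h2 : Λ ≤ (((2 * s : ℚ)) : ℝ) := hscale.2
    push_cast at h2
    linarith
  have hν' : ν ∈ Set.Icc (-(2:ℝ)) (-(3:ℝ) / 10) := ⟨by linarith [hν.1], by linarith [hν.2, hU.1]⟩
  have hgeo := hG ν hν' K hK Λ hΛ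
  refine ⟨s, hs, hsC, K, Λ, L₀, (symmetricRegimeCertificateT_iff U ν _ _ K Λ L₀).2
    ⟨hframe, hscale, ?_, hblock⟩⟩
  simpa [ladderScaleData] using hgeo

/-- `e^{-1/U²} ≤ U²` for `U ≠ 0` (from `1 + x ≤ eˣ`). [folklore] -/
theorem exp_neg_inv_sq_le_sq {U : ℝ} (hU : U ≠ 0) : Real.exp (-1 / U ^ 2) ≤ U ^ 2 := by
  have hU2 : 0 < U ^ 2 := by positivity
  have h1 : 1 / U ^ 2 + 1 ≤ Real.exp (1 / U ^ 2) := Real.add_one_le_exp _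
  have hpos : 0 < Real.exp (1 / U ^ 2) := Real.exp_pos _
  rw [show (-1 : ℝ) / U ^ 2 = -(1 / U ^ 2) by ring, Real.exp_neg]
  rw [inv_le_comm₀ hpos hU2]
  calc (U ^ 2)⁻¹ = 1 / U ^ 2 := (one_div _).symm
    _ ≤ 1 / U ^ 2 + 1 := by linarith
    _ ≤ Real.exp (1 / U ^ 2) := h1

/-- The exponent bookkeeping: for `0 < U ≤ min 1 c` and `e^{-C₁/U²} ≤ s`, `e^{-(C₁+1)/U²} ≤ c * s`. [folklore] -/
theorem exp_succ_le_mul {U C₁ c s : ℝ} (hU : 0 < U) (hU1 : U ≤ 1) (hUc : U ≤ c)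
    (hs : Real.exp (-C₁ / U ^ 2) ≤ s) : Real.exp (-(C₁ + 1) / U ^ 2) ≤ c * s := by
  have hsplit : Real.exp (-(C₁ + 1) / U ^ 2) = Real.exp (-C₁ / U ^ 2) * Real.exp (-1 / U ^ 2) := by
    rw [← Real.exp_add]; congr 1; ring
  have h2 : Real.exp (-1 / U ^ 2) ≤ c := by
    calc Real.exp (-1 / U ^ 2) ≤ U ^ 2 := exp_neg_inv_sq_le_sq hU.ne'
      _ ≤ U := by nlinarith
      _ ≤ c := hUc
  have h0s : 0 ≤ s := (Real.exp_pos _).le.trans hs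
  rw [hsplit]
  calc Real.exp (-C₁ / U ^ 2) * Real.exp (-1 / U ^ 2) ≤ s * c :=
        mul_le_mul hs h2 (Real.exp_pos _).le h0s
    _ = c * s := by ring

/-- **Certificates on `ν ∈ [μ₁, μ₂ - U/2]` + (B) give an order floor on the operator levels `μ ∈ [μ₁ + U/2, μ₂]`**
(read (B) at `ν := μ - U/2`; with `U ≤ min 1 c`, `e^{-(C₁+1)/U²} ≤ c·s`). [cite: KomaTasaki1994, §1] -/
theorem orderFloorOnLevelWindow_of_certificates {μ₁ μ₂ : ℝ}
    (hcert : ∃ U₀ C₁ : ℝ, 0 < U₀ ∧ 0 < C₁ ∧ ∀ U ∈ Set.Ioo (0:ℝ) U₀, ∀ ν ∈ Set.Icc μ₁ (μ₂ - U / 2),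
      ∃ (s : ℚ) (hs : 0 < s), Real.exp (-C₁ / U ^ 2) ≤ (s : ℝ) ∧
        ∃ (K : TrigPolyC4v) (Λ : ℝ) (L₀ : ℕ),
          symmetricRegimeCertificateT U ν (ladderScaleData s hs) ladderTolerance K Λ L₀)
    (hB : ∃ c : ℝ, 0 < c ∧ ∀ (s : ℚ) (hs : 0 < s) (U ν : ℝ), U ∈ Set.Ioc (0:ℝ) 1 →
      ∀ (K : TrigPolyC4v) (Λ : ℝ) (L₀ : ℕ),
        symmetricRegimeCertificateT U ν (ladderScaleData s hs) ladderTolerance K Λ L₀ →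
          c * (s : ℝ) ≤ dWaveOrderParameter U (ν + U / 2)) :
    ∃ U₀ C : ℝ, 0 < U₀ ∧ 0 < C ∧ ∀ U ∈ Set.Ioo (0:ℝ) U₀, ∀ μ ∈ Set.Icc (μ₁ + U / 2) μ₂,
      Real.exp (-C / U ^ 2) ≤ dWaveOrderParameter U μ := by
  obtain ⟨c, hc, hB⟩ := hB
  obtain ⟨U₀, C₁, hU₀, hC₁, hR⟩ := hcert
  refine ⟨min U₀ (min 1 c), C₁ + 1, lt_min hU₀ (lt_min one_pos hc), by linarith, fun U hU μ hμ => ?_⟩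
  have hUpos : 0 < U := hU.1
  have hUU₀ : U < U₀ := lt_of_lt_of_le hU.2 (min_le_left _ _)
  have hU1 : U ≤ 1 := (lt_of_lt_of_le hU.2 ((min_le_right _ _).trans (min_le_left _ _))).le
  have hUc : U ≤ c := (lt_of_lt_of_le hU.2 ((min_le_right _ _).trans (min_le_right _ _))).le
  have hν : μ - U / 2 ∈ Set.Icc μ₁ (μ₂ - U / 2) := by
    constructor <;> linarith [hμ.1, hμ.2]
  obtain ⟨s, hs, hsC, K, Λ, L₀, hcert⟩ := hR U ⟨hUpos, hUU₀⟩ (μ - U / 2) hν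
  have hm := hB s hs U (μ - U / 2) ⟨hUpos, hU1⟩ K Λ L₀ hcert
  rw [sub_add_cancel] at hm
  exact le_trans (exp_succ_le_mul hUpos hU1 hUc hsC) hm


/-- **The certificate chain refines (M)**: (Rloc) + (Gw, landed p141478) + (B) ⟹ (M) (`certificates_of_local`, then
`orderFloorOnLevelWindow_of_certificates`). Kernel-checked documentation of the intended proof architecture; by the leak note the
hypothesis (B) is itself ⊇ the programme, which is why (M), not the pair, is registered. [cite: KomaTasaki1994, §1] -/
theorem dWaveOrderFloorOnLeadingWindows_of_certificateChain (hR : SymmetricFlowToLadderScaleLocal)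
    (hB : BrokenRegimeAtLadderScale) :
    ∀ μ₁ μ₂ γ U₁ : ℝ, -2 ≤ μ₁ → μ₁ < μ₂ → μ₂ ≤ -(3:ℝ) / 10 → 0 < γ → 0 < U₁ →
      (∀ U ∈ Set.Ioo (0:ℝ) U₁, ∀ μ ∈ Set.Icc μ₁ μ₂, ∀ χ : D4Irrep, χ ≠ D4Irrep.B1g →
        channelInf (squareDispersion 1 0) μ U D4Irrep.B1g + γ * U ^ 2 ≤ channelInf (squareDispersion 1 0) μ U χ) →
      ∃ U₀ C : ℝ, 0 < U₀ ∧ 0 < C ∧ ∀ U ∈ Set.Ioo (0:ℝ) U₀, ∀ μ ∈ Set.Icc (μ₁ + U / 2) μ₂,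
        Real.exp (-C / U ^ 2) ≤ dWaveOrderParameter U μ := by
  intro μ₁ μ₂ γ U₁ hμ₁ h12 hμ₂ hγ hU₁ hK
  exact orderFloorOnLevelWindow_of_certificates
    (certificates_of_local Summit.HubbardSuperconductivity.HubbardSuperconductivity.Theorems.stub_ladderShellGeometryWide
      hμ₁ hμ₂ (hR μ₁ μ₂ γ U₁ hμ₁ h12 hμ₂ hγ hU₁ hK)) hB

/-! ### Composition, part 3: the two stubs imply the crux BY NAME -/

/-- **The line closes the crux modulo its stubs.** (Kpt) ⟹ (Kwin, landed p141740) a level window `[μ₁, μ₂]` with certified fillings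
in `(13/25, 7/10)` on which `B₁g` leads by `γU²`; (F1)/(F2, landed p141417) place it inside `[-2, -3/10]` (strictly monotone free
filling); (M) gives the floor `e^{-C/U²} ≤ dWaveOrderParameter U μ` on `μ ∈ [μ₁ + U/2, μ₂]`; the landed record-free transfer
`Theorems.stub_cruxOfOrderFloorOnCertifiedLevelWindow` (p142268; c1's generic-`μ` density frame inside) concludes.
[folklore: Griffiths 1964 + landed tree lemmas] [cite: KomaTasaki1994, §1] -/
theorem CwChiralConstruction_of : CwChiralConstruction := by
  obtain ⟨μ₁, μ₂, γ, U₁, h4, h12, h0, hγ, hU₁, hn₁, hn₂, hK⟩ :=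
    stub_klLeadingMuWindowOfPoint stub_klLeadingAtWindowDoping
  -- (F1): `n(μ₁) > 13/25 > 1/2 ≥ n(-2)` forces `-2 ≤ μ₁`
  have hμ₁ : -2 ≤ μ₁ := by
    by_contra hlt
    have hlt : μ₁ < -2 := not_le.mp hlt
    have := monotone_filling hlt.le
    linarith [filling_neg_two_le_half]
  -- (F2): `n(μ₂) < 7/10 ≤ n(-3/10)` forces `μ₂ ≤ -3/10`
  have hμ₂ : μ₂ ≤ -(3:ℝ) / 10 := by
    by_contra hlt
    have hlt : -(3:ℝ) / 10 < μ₂ := not_le.mp hlt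
    have := monotone_filling hlt.le
    linarith [stub_fillingAtNegThreeTenths]
  exact Summit.HubbardSuperconductivity.HubbardSuperconductivity.Theorems.stub_cruxOfOrderFloorOnCertifiedLevelWindow
    μ₁ μ₂ h12 hn₁ hn₂ (stub_dWaveOrderFloorOnLeadingWindows μ₁ μ₂ γ U₁ hμ₁ h12 hμ₂ hγ hU₁ hK)

/-! ### Sanity anchor (no new content): the floor sits below the adversary's ceiling -/

/-- The adversary's Cooper–Legendre ceiling (Disproof §C, landed `Negative/CooperLegendreCeiling.lean`), re-exported on the
level range `[-2, -3/10]` so the skeleton's check imports the landed Negative lemma (crux protocol): there is `K > 0` with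
`dWaveOrderParameter U μ ≤ K(1+|log U|)√U` for `U ∈ (0, 1]`, `μ ∈ [-2, -3/10]`. The floor this line produces there,
`e^{-(C₁+1)/U²}`, is far below. [cite: KomaTasaki1994, §1] -/
theorem ceiling_anchor :
    ∃ K : ℝ, 0 < K ∧ ∀ U μ : ℝ, 0 < U → U ≤ 1 → μ ∈ Set.Icc (-(2:ℝ)) (-(3:ℝ) / 10) →
      dWaveOrderParameter U μ ≤ K * (1 + |Real.log U|) * Real.sqrt U :=
  Summit.HubbardSuperconductivity.CwChiralConstruction.Negative.dWaveOrderParameter_le_sqrt _ _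
    (by norm_num) (by norm_num) (by norm_num)

end Summit.HubbardSuperconductivity.HubbardSuperconductivity.Cruxes.CwChiralConstruction.LadderScaleTransfer
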